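import Mathlib
import Summits.Ventures.PercRepro2.Defs
import Summits.Ventures.PercRepro2.Independence
import Summits.Ventures.PercRepro2.Harris
import Summits.Ventures.PercRepro2.Graph
import Summits.Ventures.PercRepro2.Exploration
import Summits.Ventures.PercRepro2.Induced
import Summits.Ventures.PercRepro2.R1Rung
import Summits.Ventures.PercRepro2.CC2Rung
import Summits.Ventures.PercRepro2.MonoT
import Summits.Ventures.PercRepro2.Events
import Summits.Ventures.PercRepro2.FourFunctions
import Summits.Ventures.PercRepro2.Frontier
import Summits.Ventures.PercRepro2.ObsIndependence
import Summits.Ventures.PercRepro2.BHK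
import Summits.Ventures.PercRepro2.BHKEvents
import Summits.Ventures.PercRepro2.MultiSource
import Summits.Ventures.PercRepro2.OrderPreservation
import Summits.Ventures.PercRepro2.SeedSet
import Summits.Ventures.PercRepro2.MultiSourceFun
import Summits.Ventures.PercRepro2.CrossRootT
import Summits.Ventures.PercRepro2.VdBKahn
import Summits.Ventures.PercRepro2.HullDefs
import Summits.Ventures.PercRepro2.CCTRootEdge
import Summits.Ventures.PercRepro2.CCTAvoidedEdge
import Summits.Ventures.PercRepro2.MonoTReduction

/-!
# The non-degeneracy hypothesis of `CC2_of_monoU` discharged on `p ∈ (0,1)^E`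
(blind cell PercRepro2, typer-1; lead g11 12:34:16Z "a corollary `CC2_of_monoU_of_pos`
discharging `0 < massP p[e↦0] s (insert u T)` is the clean form")

The all-closed configuration `ω₀ = (fun _ => false)` has weight `∏ e, (1 - p e)`, positive as soon
as every `p e < 1`; in `ω₀` the cluster of `s` is `{s}`, so `ω₀ ∈ R_X = avoidAll ends s X` whenever
`s ∉ X`. Hence **`massP_pos_of_lt_one`**: `P(R_X) > 0` for every `X ∌ s` and every weight vector
with `p e < 1` on every edge — in particular for `p[e↦0]` when `p` is such a vector. With it,
`MonoT.CC2_of_monoU` specialises to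

* **`CC2_of_monoU_of_lt_one`** — `(MONO-u) at (T, u) ⟹ (CC-T) at T` for `IsProbVec p`,
  `∀ e, p e < 1`, `s ∉ T`, `s ≠ u`;
* **`CC2_of_monoU_of_pos`** — the same on the rows of record `p ∈ (0,1)^E`;
* **`CC2_of_monoU_all`** — from the closure `MonoU_all R`: (CC-T) at every free-edge instance
  `e = {u, w}`, `s ∉ T ∪ e`, `T ∩ e = ∅`, with an endpoint `u ∉ A ∪ B`, on `p ∈ [0,1)^E`.

The positivity API (`conn_allClosed_iff`, `allClosed_mem_avoidAll`, `weight_le_prob_of_mem`,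
`weight_allClosed_pos`) is general and lives at the top level of the namespace.
-/

namespace Summit.Ventures.PercRepro2

/-! ## The all-closed configuration -/

section AllClosedConfig

variable {V : Type*} {E : Type*}

/-- In the all-closed configuration the open subgraph is empty. -/
lemma openGraph_allClosed (ends : E → Sym2 V) :
    openGraph ends (fun _ => false) = ⊥ := by
  ext u v
  simp [openGraph_adj, OpenAdj]

/-- In the all-closed configuration `u ↔ v` iff `u = v`. -/
lemma conn_allClosed_iff (ends : E → Sym2 V) (u v : V) :
    Conn ends (fun _ => false) u v ↔ u = v := by
  rw [Conn, openGraph_allClosed, SimpleGraph.reachable_bot]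

/-- The all-closed configuration lies in `R_X = {s ↮ X}` whenever `s ∉ X`. -/
lemma allClosed_mem_avoidAll (ends : E → Sym2 V) {s : V} {X : Finset V} (hs : s ∉ X) :
    (fun _ => false : Config E) ∈ avoidAll ends s X := by
  intro x hx hc
  rw [conn_allClosed_iff] at hc
  exact hs (hc ▸ hx)

end AllClosedConfig

/-! ## Single-configuration lower bounds -/

section Positivity

variable {E : Type*} [Fintype E] [DecidableEq E] {R : Type*} [CommRing R] [PartialOrder R]
  [IsOrderedRing R]

/-- The weight of one configuration of an event is a lower bound for its probability. -/
lemma weight_le_prob_of_mem {p : E → R} (hp : IsProbVec p) {A : Set (Config E)} {ω : Config E}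
    (hω : ω ∈ A) : weight p ω ≤ prob p A := by
  unfold prob
  have h : weight p ω = A.indicator (weight p) ω := by simp [hω]
  rw [h]
  exact Finset.single_le_sum
    (fun ω' _ => Set.indicator_apply_nonneg fun _ => weight_nonneg hp ω') (Finset.mem_univ ω)

omit [DecidableEq E] [PartialOrder R] [IsOrderedRing R] in
/-- The weight of the all-closed configuration is `∏ e, (1 - p e)`. -/
lemma weight_allClosed_eq (p : E → R) : weight p (fun _ => false) = ∏ e, (1 - p e) := by
  simp [weight, edgeFactor]

omit [DecidableEq E] [IsOrderedRing R] in
/-- The all-closed configuration has positive weight when every `p e < 1`. -/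
lemma weight_allClosed_pos [IsStrictOrderedRing R] {p : E → R} (h : ∀ e, p e < 1) :
    0 < weight p (fun _ => false) := by
  rw [weight_allClosed_eq]
  exact Finset.prod_pos fun e _ => sub_pos.2 (h e)

omit [Fintype E] [IsOrderedRing R] in
/-- Pinning an edge closed keeps every weight `< 1`. -/
lemma update_zero_lt_one [IsStrictOrderedRing R] {p : E → R} (h : ∀ e, p e < 1) (e : E) :
    ∀ e', Function.update p e 0 e' < 1 := by
  intro e'
  by_cases he : e' = e
  · subst he; simp
  · rw [Function.update_of_ne he]; exact h e'

omit [IsOrderedRing R] in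
/-- **`P(R_X) > 0`** for every avoided set `X ∌ s` when every `p e < 1`: the all-closed
configuration is in `R_X` and has positive weight. -/
lemma massP_pos_of_lt_one [IsStrictOrderedRing R] {V : Type*} {p : E → R} (hp : IsProbVec p)
    (hlt : ∀ e, p e < 1) (ends : E → Sym2 V) {s : V} {X : Finset V} (hs : s ∉ X) :
    0 < TwoSetRung.massP p ends s X :=
  (weight_allClosed_pos hlt).trans_le (weight_le_prob_of_mem hp (allClosed_mem_avoidAll ends hs))

end Positivity

/-! ## `CC2_of_monoU` without the non-degeneracy hypothesis -/

namespace MonoT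

open TwoSetRung

variable {V : Type*} {E : Type*} [Fintype E] [DecidableEq E] [Fintype V] [DecidableEq V]
  {R : Type*} [Field R] [LinearOrder R] [IsStrictOrderedRing R]

variable (p : E → R) (ends : E → Sym2 V) {e : E} (s : V) (A B : Finset V) (T : Finset V)

/-- **(CC-T) at `T` from (MONO-u) at `(T, u)`** on weights `p e < 1` (every edge): the
non-degeneracy `P₀(T ∪ {u}) > 0` of `CC2_of_monoU` is automatic when `s ∉ T` and `s ≠ u`. -/
theorem CC2_of_monoU_of_lt_one (hp : IsProbVec p) (hlt : ∀ e, p e < 1) {u w : V}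
    (hends : ends e = s(u, w)) (hsT : s ∉ T) (hsu : s ≠ u)
    (hmono : MonoU p ends e s A B T u) : CC2 p ends e s A B T T := by
  refine CC2_of_monoU p ends s A B T hp hends hmono ?_
  refine massP_pos_of_lt_one (hp.update e le_rfl zero_le_one) (update_zero_lt_one hlt e) ends ?_
  simp [hsT, hsu]

/-- **(CC-T) at `T` from (MONO-u) at `(T, u)`** on the rows of record `p ∈ (0,1)^E`
(lead g11 12:34:16Z). -/
theorem CC2_of_monoU_of_pos (hp : ∀ e, 0 < p e ∧ p e < 1) {u w : V}
    (hends : ends e = s(u, w)) (hsT : s ∉ T) (hsu : s ≠ u)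
    (hmono : MonoU p ends e s A B T u) : CC2 p ends e s A B T T :=
  CC2_of_monoU_of_lt_one p ends s A B T ⟨fun e => (hp e).1.le, fun e => (hp e).2.le⟩
    (fun e => (hp e).2) hends hsT hsu hmono

end MonoT

/-! ## The closure form -/

namespace MonoT

open TwoSetRung

variable (R : Type*) [Field R] [LinearOrder R] [IsStrictOrderedRing R]

/-- **From the closure `MonoU_all`**: (CC-T) holds at every free-edge instance (`e = {u, w}`,
`s ∉ T`, `s ∉ e`, `T ∩ e = ∅`) with an endpoint `u ∉ A ∪ B`, on every weight vector with
`p e < 1` for all `e`. -/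
theorem CC2_of_monoU_all (hrow : MonoU_all R) :
    ∀ (V E : Type) [Fintype V] [DecidableEq V] [Fintype E] [DecidableEq E]
      (ends : E → Sym2 V) (p : E → R), IsProbVec p → (∀ e, p e < 1) →
      ∀ (e : E) (s : V) (T : Finset V) (A B : Finset V) (u w : V), ends e = s(u, w) →
        s ∉ T → s ∉ ends e → (∀ t ∈ T, t ∉ ends e) → u ∉ A → u ∉ B →
        CC2 p ends e s A B T T := by
  intro V E _ _ _ _ ends p hp hlt e s T A B u w hends hsT hse hT huA huB
  have hu : u ∈ ends e := by rw [hends]; exact Sym2.mem_mk_left u w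
  have hsu : s ≠ u := fun h => hse (h ▸ hu)
  exact CC2_of_monoU_of_lt_one p ends s A B T hp hlt hends hsT hsu
    (hrow V E ends p hp e s T A B u hsT hse hT hu huA huB)

end MonoT

end Summit.Ventures.PercRepro2
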